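/-
Copyright: cell pub-balaban-gaps (YM BLITZ Y1, track G1), seat g1-p2 GEN 11 (unit `pub-balaban-gaps-g1-p2`).  Row (D4) NODE O, MODEL level:
the GAUGE PRESENTATION for 59b–66's one-scale covariant operator — `fibD g·covOp(W⁺, W⁻, P_K(U))·fibD g⁻ = covOp(W⁺ᵍ, W⁻ᵍ, P_K(U)ᵍ)` with the
gauged defects `1 + W⁺ᵍ_μ(x) = g(x)(1 + W⁺_μ(x))g⁻(x + e_μ)`, `1 + W⁻ᵍ_μ(x) = g(x)(1 + W⁻_μ(x))g⁻(x − e_μ)` and the gauged block-contour transporters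
`U(Γ_{y,x})ᵍ = U(Γ_{y,x})g⁻(x)`, `(U(Γ_{y,x})⁻¹)ᵍ = g(x)U(Γ_{y,x})⁻¹` — the one-scale twin of 90's carrier-generic `covLap_gauge`, run on 90's
`gauge_shift_term` ∕ `fibD_mul` BY NAME (59b's `fibDiag`, `Sf`, `SBf` ARE 90's `fibD`, `relab` by `rfl`).  This is print's (3.35): the operator of
the (L) step is read in the cube's own gauge `u_□`, where the defects are small.  HONEST FRAMING: algebra ([folklore]); Bałaban's `Δ^{(k)}(𝐔)` NOT
constructed; (D4) instance 0∕1; NOT BetaPertH, NOT continuum, NOT Clay.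
-/
import Summits.QuantumFields.BalabanUV.Gaps.D4WalkBlockGaugeAlgebra
import Summits.QuantumFields.BalabanUV.Gaps.D4WalkBlockCovariantBlockAveraging

/-!
# `Gaps.D4WalkBlockFormGaugeTorus` — gauge covariance of the one-scale covariant operator `Δ_W + m² + a_KP_K(U)` on the fine torus
# (cell pub-balaban-gaps, seat g1-p2 gen 11)

HONEST DEPENDENCY (cell pub-balaban, verbatim): continuum YM on T⁴ ⇐ BetaPertH ∧ nine spine estimates (0/9 proved); BetaPertH ⇐ (D1) ∧ (D4) ∧ CAP+tail.

[B9] p. 398 ∕ (3.35) p. 396 ∕ (3.50) p. 400: under a site gauge `g` the bond variables go to `g(x)U(x,x′)g(x′)⁻¹`, the covariant Laplacian and the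
averaging operators are conjugated by `fibD g`, and on a cube one chooses `g = u_□` with `U^{u_□} = e^{iηA}`, `A` small.  ([folklore] algebra):
* §1 the dictionary `fibDiag_eq_fibD`, `Sf_eq_relab`, `SBf_eq_relab` (all `rfl`), `one_add_fibD`;
* §2 **`covLap_gauge`** (`fibD g·Δ_W·fibD g⁻ = Δ_{Wᵍ}`), `smul_one_gauge`, **`PU_gauge`** (`fibD g·P_K(U)·fibD g⁻ = P_K(Uᵍ)`, 64's `PU`),
  **`covOp_gauge`** (`fibD g·covOp(W⁺, W⁻, P_K(U))·fibD g⁻ = covOp(W⁺ᵍ, W⁻ᵍ, P_K(Uᵍ))`).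
WHAT IT IS NOT.  The per-cube coercivity in the cube's gauge (= 114 ∕ 117 applied to the gauged defects, whose windows are print's (3.37) on the cube)
and 104's END are NOT here; (D4) instance 0∕1; words of row (D4) UNCHANGED (`ExistsUniformAcrossSmall 𝓣_Bałaban α Rσ₀ θ₀` + `TermDomination`, OBJECT level).

References (method only): T. Bałaban, Comm. Math. Phys. **99** (1985) 389–434 [B9], (3.8) p. 392, (3.35) p. 396, p. 398, (3.50) p. 400.
-/

noncomputable section

namespace Summit.QuantumFields.BalabanUV.Gaps.D4WalkBlockFormGaugeTorus

open Finset Complex Matrix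
open scoped BigOperators Matrix
open Literature.MathematicalPhysics.QuantumFieldTheory.Balaban1983to89
open Literature.MathematicalPhysics.QuantumFieldTheory.Balaban1983to89.B5Ineq137Torus (blk)
open Summit.QuantumFields.BalabanUV.Gaps.D4WalkBlockShiftAlgebra (fibD relab)
open Summit.QuantumFields.BalabanUV.Gaps.D4WalkBlockShiftWeighted (fibD_mul)
open Summit.QuantumFields.BalabanUV.Gaps.D4WalkBlockGaugeAlgebra (fibD_const_one fibD_mul_fibD_eq_one gauge_shift_term fibD_mul_mul_fibD_apply)
open Summit.QuantumFields.BalabanUV.Gaps.D4WalkBlockCovariantGeometry (fibDiag SBf fibDiag_add)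
open Summit.QuantumFields.BalabanUV.Gaps.D4WalkBlockCovariantShift (Sf covLap)
open Summit.QuantumFields.BalabanUV.Gaps.D4WalkBlockCovariantPropagator (covOp)
open Summit.QuantumFields.BalabanUV.Gaps.D4WalkBlockCovariantBlockAveraging (PU wK)

variable {P : Params} {F : Type} [Fintype F] [DecidableEq F]
variable {E : Type*}

/-! ## §1. Dictionary: 59b's fibred objects are 90's -/

omit [Fintype F] [DecidableEq F] in
/-- `fibDiag = fibD` (same definition). -/
theorem fibDiag_eq_fibD (w : Site P 0 → Matrix F F ℂ) : fibDiag P F w = fibD (Site P 0) F w := rfl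

omit [Fintype F] in
/-- `S_μ ⊗ 1 = relab (· + e_μ)`. -/
theorem Sf_eq_relab (μ : Fin P.d) : Sf P F μ = relab (Site P 0) F (fun x => Site.shift x μ) := rfl

omit [Fintype F] in
/-- `S⁻_μ ⊗ 1 = relab (· − e_μ)`. -/
theorem SBf_eq_relab (μ : Fin P.d) : SBf P F μ = relab (Site P 0) F (fun x => Site.unshift x μ) := rfl

omit [Fintype F] in
/-- `1 + fibD W = fibD (1 + W)`. -/
theorem one_add_fibD (W : Site P 0 → Matrix F F ℂ) : 1 + fibD (Site P 0) F W = fibD (Site P 0) F (fun x => 1 + W x) := by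
  rw [← fibD_const_one, ← D4WalkBlockShiftAlgebra.fibD_add]

/-! ## §2. Gauge covariance -/

variable (g gi : Site P 0 → Matrix F F ℂ) (Wp Wm : Fin P.d → E → Site P 0 → Matrix F F ℂ) (Ug Ugi : E → Site P 0 → Matrix F F ℂ)
  (a msq : ℝ)

/-- **GAUGE COVARIANCE OF THE ONE-SCALE COVARIANT LAPLACIAN**: `fibD g·Δ_W(u)·fibD g⁻ = Δ_{Wᵍ}(u)` with
`W⁺ᵍ_μ(u,x) = g(x)(1 + W⁺_μ(u,x))g⁻(x + e_μ) − 1`, `W⁻ᵍ_μ(u,x) = g(x)(1 + W⁻_μ(u,x))g⁻(x − e_μ) − 1` (for `gg⁻ = 1` sitewise).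
[cite: Balaban1985BackgroundPropagators, p.398, (3.50) p.400] -/
theorem covLap_gauge (hg : ∀ x, g x * gi x = 1) (u : E) :
    fibD (Site P 0) F g * covLap P F Wp Wm u * fibD (Site P 0) F gi
      = covLap P F (fun μ u x => g x * (1 + Wp μ u x) * gi (Site.shift x μ) - 1)
          (fun μ u x => g x * (1 + Wm μ u x) * gi (Site.unshift x μ) - 1) u := by
  unfold covLap
  rw [Matrix.mul_smul, Matrix.smul_mul, Finset.mul_sum, Finset.sum_mul]
  refine congrArg _ (Finset.sum_congr rfl fun μ _ => ?_)
  simp only [fibDiag_eq_fibD, Sf_eq_relab, SBf_eq_relab, one_add_fibD]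
  rw [Matrix.mul_sub, Matrix.mul_sub, Matrix.sub_mul, Matrix.sub_mul, Matrix.mul_smul, Matrix.smul_mul, Matrix.mul_one,
    fibD_mul_fibD_eq_one hg, gauge_shift_term, gauge_shift_term]
  simp only [add_sub_cancel]

/-- the mass term is gauge invariant: `fibD g·(c•1)·fibD g⁻ = c•1`. -/
theorem smul_one_gauge (hg : ∀ x, g x * gi x = 1) (c : ℂ) :
    fibD (Site P 0) F g * (c • (1 : Matrix (Site P 0 × F) (Site P 0 × F) ℂ)) * fibD (Site P 0) F gi = c • 1 := by
  rw [Matrix.mul_smul, Matrix.mul_one, Matrix.smul_mul, fibD_mul_fibD_eq_one hg]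

omit [DecidableEq F] in
/-- **GAUGE COVARIANCE OF THE BLOCK-AVERAGING PROJECTOR**: `fibD g·P_K(U)·fibD g⁻ = P_K(Uᵍ)` with the gauged block-contour transporters
`U(Γ_{y,x})ᵍ = U(Γ_{y,x})g⁻(x)`, `(U(Γ_{y,x})⁻¹)ᵍ = g(x)U(Γ_{y,x})⁻¹` (64's `PU`). [cite: Balaban1985BackgroundPropagators, (3.8) p.392, p.398] -/
theorem PU_gauge (u : E) :
    fibD (Site P 0) F g * PU P F Ug Ugi u * fibD (Site P 0) F gi = PU P F (fun u x => Ug u x * gi x) (fun u x => g x * Ugi u x) u := by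
  ext p q
  rw [fibD_mul_mul_fibD_apply, PU, PU, Matrix.of_apply]
  by_cases hb : blk P P.K p.1 = blk P P.K q.1
  · rw [if_pos hb]
    have e : (Matrix.of fun a b => (Matrix.of fun p' q' : Site P 0 × F =>
        if blk P P.K p'.1 = blk P P.K q'.1 then (wK P : ℂ) * (Ugi u p'.1 * Ug u q'.1) p'.2 q'.2 else 0) (p.1, a) (q.1, b))
        = (wK P : ℂ) • (Ugi u p.1 * Ug u q.1) := by
      ext a b; simp only [Matrix.of_apply, if_pos hb, Matrix.smul_apply, smul_eq_mul]
    rw [e, Matrix.mul_smul, Matrix.smul_mul, Matrix.smul_apply, smul_eq_mul]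
    congr 1
    simp only [Matrix.mul_assoc]
  · rw [if_neg hb]
    have e : (Matrix.of fun a b => (Matrix.of fun p' q' : Site P 0 × F =>
        if blk P P.K p'.1 = blk P P.K q'.1 then (wK P : ℂ) * (Ugi u p'.1 * Ug u q'.1) p'.2 q'.2 else 0) (p.1, a) (q.1, b))
        = 0 := by
      ext a b; simp only [Matrix.of_apply, if_neg hb, Matrix.zero_apply]
    rw [e, Matrix.mul_zero, Matrix.zero_mul, Matrix.zero_apply]

/-- **GAUGE COVARIANCE OF THE ONE-SCALE COVARIANT OPERATOR**: `fibD g·(Δ_W + m² + a_KP_K(U))(u)·fibD g⁻ = (Δ_{Wᵍ} + m² + a_KP_K(Uᵍ))(u)` — the operator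
of the (L) step read in the cube's own gauge. [cite: Balaban1985BackgroundPropagators, (3.35) p.396, p.398, (3.50) p.400] -/
theorem covOp_gauge (hg : ∀ x, g x * gi x = 1) (u : E) :
    fibD (Site P 0) F g * covOp P F Wp Wm (PU P F Ug Ugi) a msq u * fibD (Site P 0) F gi
      = covOp P F (fun μ u x => g x * (1 + Wp μ u x) * gi (Site.shift x μ) - 1)
          (fun μ u x => g x * (1 + Wm μ u x) * gi (Site.unshift x μ) - 1)
          (PU P F (fun u x => Ug u x * gi x) (fun u x => g x * Ugi u x)) a msq u := by
  unfold covOp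
  rw [Matrix.mul_add, Matrix.mul_add, Matrix.add_mul, Matrix.add_mul, covLap_gauge g gi Wp Wm hg, smul_one_gauge g gi hg,
    Matrix.mul_smul, Matrix.smul_mul, PU_gauge]

end Summit.QuantumFields.BalabanUV.Gaps.D4WalkBlockFormGaugeTorus

end
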